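import Summits.AtomisticToContinuum.HydrodynamicLimit.Theorems.AntiMazurCoboundariesCorrectorPressureDecayKiferUniformGibbsPieces
import Summits.AtomisticToContinuum.HydrodynamicLimit.Theorems.AntiMazurCoboundariesCorrectorPressureDecayKiferGibbsReferenceSwap
import Summits.AtomisticToContinuum.HydrodynamicLimit.Theorems.AntiMazurCoboundariesCorrectorPressureDecayKiferKLBasePointConvexity
import Summits.AtomisticToContinuum.HydrodynamicLimit.Theorems.AntiMazurCoboundariesCorrectorPressureDecayKiferCanonicalCellTupleCore
import Summits.AtomisticToContinuum.BoseEinsteinCondensation.Theorems.BECCellInformationOneBodyEntropyBoundCagingBound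

/-!
# The Gibbs route to the uniform entropy bound, II: the window estimate at fixed size
(line `FirstLemma`, crux stmt-AtomisticToContinuum-14135 `AntiMazurCoboundaries.CorrectorPressureDecay`)

Core of the registered stub `tangentEntropyBoundUniformGibbs_of_pieces : CanonicalCellInequality → CanonicalBlockFreeEntropy →
TangentEntropyBoundUniformGibbs` (…KiferUniformGibbsGlue.lean), namespace
`Summit.AtomisticToContinuum.HydrodynamicLimit.Theorems.KiferCompactification`; lead seat c9. Everything here is at a FIXED size `N`:

* `c9_integral_klDiv_window_le_of_cellInequality` — **the window estimate**: for a probability law `Q` on `(N+1)`-particle torus phase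
  space, a translation-invariant DLR state `G ∈ Gibbs(z)` of the unit-diameter gas, the open cube `U_n = (-(n+2), n+2)³` and `m ≥ 7` cells
  per side of the blown-up torus cube `(-S/2, S/2]³`, `S = ε_N⁻¹`, with `2(n+2) ≤ S/m`,
  `KL((blowUpLaw σ 1 N Q)_{U_n} ‖ G_{U_n}) ≤ (KL(Q ‖ G_N) + c_N(m)) / m³ + z C` (`C` a bound on the volumes of the unit collars of the cells),
  given the cell inequality `CanonicalCellInequality` (…KiferUniformGibbsPieces.lean). Route, for each base point `x` of the blow-up
  (convexity, `klDiv_windowLaw_blowUpLaw_one_le_lintegral` from `c9_klDiv_map_prod_le_lintegral_const`): move the window `U_n` to a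
  translate `c + U_n` inside the cell `j₀ ∋` centre (`exists_image_const_add_subset_c9Cell`) by the configuration seam lemma
  `windowRestrict_translate_blowUp` and the translation invariance of `G` and of `KL` (`klDiv_windowLaw_blowUp_eq_translate`; the base
  point moves to `x - proj (ε c)`), enlarge to the cell (data processing `klDiv_windowLaw_mono`), swap `G_{cell}` for the FREE cell measure
  `γ_{cell} = gibbsSpecMeasure 1 z θ⁻¹ u₀ cell ∅` at the cost `z · vol(unit collar of the cell)` (`c9_klDiv_windowLaw_gibbs_le_klDiv_free_add`),
  reduce the cell `j₀` to the cell `0` at a shifted base point (`klDiv_windowLaw_c9Cell_eq`: cell seam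
  lemma `c9_windowRestrict_cell_blowUp_eq_translate` + covariance `c9_gibbsSpecMeasure_empty_translate` + `c9_klDiv_map_translate_eq`); the
  Haar average of the cell-`0` entropy is then `m⁻³` times the average of the sum over all `m³` cells (`card_mul_lintegral_le_of_forall_sum_le`,
  Haar measure is translation invariant), which the cell inequality bounds by `KL(Q ‖ G_N) + c_N(m)`.
* Bookkeeping: open coordinate boxes of `ℝ³` (open, bounded), cells are bounded, `‖y‖ ≤ 2 max|yᵢ|`, the blow-up around a fixed base
  point is measurable, `weightLaw 1 = Haar`.

Design note. The reference is kept equal to the Gibbs state `G` through the lower-semicontinuity and convexity steps of the glue and is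
swapped for the free cell measure only AT THE CELL, after the enlargement `c + U_n ⊆ cell`: the available comparisons of a free measure with
the marginal of a larger one (`c9_windowLaw_gibbs_ge_free`, `c9_windowLaw_free_ge_free`) bound `KL(· ‖ marginal)` by `KL(· ‖ free) + z·vol(collar)`
and not conversely. No new definitions. References: S. Olla, S. R. S. Varadhan, H.-T. Yau, Comm. Math. Phys. 155 (1993) §4–5; H.-O. Georgii,
*Gibbs Measures and Phase Transitions* (2011) §15; C. Kipnis, C. Landim, *Scaling Limits of Interacting Particle Systems* (1999) App. 1.
-/

noncomputable section

open MeasureTheory ProbabilityTheory Set Filter Topology InformationTheory Metric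
open scoped ENNReal NNReal

namespace Summit.AtomisticToContinuum.HydrodynamicLimit.Theorems.KiferCompactification

open Literature.MathematicalPhysics.KineticTheory (T3 V3 hsDiameter hsDiameter_pos localGibbsLaw blowUpPoint blowUp
  succ_mul_hsDiameter_pow_three)
open Literature.MathematicalPhysics.KineticTheory.PointProcess (windowLaw windowRestrict centredBox measurable_windowRestrict
  isProbabilityMeasure_windowLaw)
open Literature.Analysis.FluidPDE (HardSphereFlow Config IsHardSphereGibbs IsTranslationInvariant)
open Literature.Analysis.FunctionSpaces (PointConfig)
open Literature.Analysis.FunctionSpaces.Torus (proj)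

/-! ## Boxes and cells of `ℝ³` -/

/-- A coordinate box `{y | ∀ i, y i ∈ (lo i, hi i)}` as the preimage of a product of intervals under `WithLp.ofLp`. -/
theorem setOf_forall_apply_mem_Ioo_eq (lo hi : Fin 3 → ℝ) :
    {y : V3 | ∀ i, y i ∈ Ioo (lo i) (hi i)} = (WithLp.ofLp : V3 → Fin 3 → ℝ) ⁻¹' Set.pi univ fun i => Ioo (lo i) (hi i) := by
  ext y; simp

/-- Open coordinate boxes are open. -/
theorem isOpen_setOf_forall_apply_mem_Ioo (lo hi : Fin 3 → ℝ) : IsOpen {y : V3 | ∀ i, y i ∈ Ioo (lo i) (hi i)} := by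
  rw [setOf_forall_apply_mem_Ioo_eq]
  exact (isOpen_set_pi finite_univ fun i _ => isOpen_Ioo).preimage (PiLp.continuous_ofLp 2 _)

/-- Open coordinate boxes are bounded. -/
theorem isBounded_setOf_forall_apply_mem_Ioo (lo hi : Fin 3 → ℝ) :
    Bornology.IsBounded {y : V3 | ∀ i, y i ∈ Ioo (lo i) (hi i)} :=
  Literature.MathematicalPhysics.StatisticalMechanics.isBounded_of_forall_mem_Icc (a := lo) (b := hi)
    fun _ hy i => Ioo_subset_Icc_self (hy i)

/-- Cells are bounded. -/
theorem isBounded_c9Cell (S : ℝ) (m : ℕ) (j : Fin 3 → Fin m) : Bornology.IsBounded (c9Cell S m j) :=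
  Literature.MathematicalPhysics.StatisticalMechanics.isBounded_of_forall_mem_Icc
    (a := fun i => -S / 2 + ((j i : ℕ) : ℝ) * (S / m)) (b := fun i => -S / 2 + (((j i : ℕ) : ℝ) + 1) * (S / m))
    fun _ hy i => Ioc_subset_Icc_self (hy i)

/-- `‖y‖ ≤ 2t` for a vector of `ℝ³` with coordinates bounded by `t` (`√3 ≤ 2`). -/
theorem norm_le_two_mul_of_forall_abs_apply_le {y : V3} {t : ℝ} (ht : 0 ≤ t) (h : ∀ i, |y i| ≤ t) : ‖y‖ ≤ 2 * t := by
  have hsum : ∑ i, ‖y i‖ ^ 2 ≤ ∑ _i : Fin 3, t ^ 2 := Finset.sum_le_sum fun i _ => by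
    rw [Real.norm_eq_abs]
    exact pow_le_pow_left₀ (abs_nonneg _) (h i) 2
  rw [Finset.sum_const, Finset.card_univ, Fintype.card_fin, nsmul_eq_mul, Nat.cast_ofNat] at hsum
  rw [EuclideanSpace.norm_eq]
  calc Real.sqrt (∑ i, ‖y i‖ ^ 2) ≤ Real.sqrt ((2 * t) ^ 2) := Real.sqrt_le_sqrt (hsum.trans (by nlinarith [sq_nonneg t]))
    _ = 2 * t := Real.sqrt_sq (by positivity)

/-! ## A Haar average bounds the integral by the sum over translates -/

/-- **Haar averaging**: if the sum of `F` over the translates `x + t j` of every base point is at most `B`, then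
`(#ι) · ∫ F dx ≤ B` for the Haar probability measure `dx` of the torus (`∑ ∫⁻ ≤ ∫⁻ ∑` needs no measurability: the tree's
`…BoseEinsteinCondensation…Caging.sum_lintegral_le`). -/
theorem card_mul_lintegral_le_of_forall_sum_le {ι : Type*} [Fintype ι] (t : ι → T3) (F : T3 → ℝ≥0∞) {B : ℝ≥0∞}
    (h : ∀ x, ∑ j, F (x + t j) ≤ B) : (Fintype.card ι : ℝ≥0∞) * ∫⁻ x, F x ≤ B := by
  calc (Fintype.card ι : ℝ≥0∞) * ∫⁻ x, F x = ∑ _j : ι, ∫⁻ x, F x := by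
        rw [Finset.sum_const, Finset.card_univ, nsmul_eq_mul]
    _ = ∑ j, ∫⁻ x, F (x + t j) := Finset.sum_congr rfl fun j _ => (lintegral_add_right_eq_self F (t j)).symm
    _ ≤ ∫⁻ x, ∑ j, F (x + t j) :=
        Summit.AtomisticToContinuum.BoseEinsteinCondensation.Cruxes.OneBodyEntropyBound.Birth.Caging.sum_lintegral_le volume _ _
    _ ≤ ∫⁻ _x, B := lintegral_mono h
    _ = B := by rw [lintegral_const, measure_univ, mul_one]

/-! ## Blow-ups around a base point -/

/-- The blow-up around a fixed base point is measurable in the torus configuration. -/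
theorem measurable_blowUp_left (ε : ℝ) (x : T3) (M : ℕ) : Measurable fun z : Config M (Fin 3) T3 => blowUp ε x z := by
  have h1 : Measurable fun z : Config M (Fin 3) T3 => ((x, z) : T3 × Config M (Fin 3) T3) := measurable_prodMk_left
  have h := (measurable_blowUp ε M).comp h1
  simp only [Function.comp_def] at h
  exact h

/-- The unit weight: `weightLaw 1` is the Haar probability measure of the torus. -/
theorem weightLaw_one : weightLaw (fun _ : T3 => (1 : ℝ)) = volume := by
  rw [weightLaw]
  have h : (fun x : T3 => ((Real.toNNReal ((∫ _ : T3, (1 : ℝ))⁻¹ * 1) : ℝ≥0) : ℝ≥0∞)) = fun _ => 1 := by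
    funext x; simp
  rw [h]
  exact withDensity_one

/-- **Convexity in the base point** (from `c9_klDiv_map_prod_le_lintegral_const`): the window entropy of the unit-weight
blown-up law relative to a fixed reference is at most the Haar average of the window entropies of the blow-ups around the
base points. -/
theorem klDiv_windowLaw_blowUpLaw_one_le_lintegral {σ : ℝ} {N : ℕ} (Q : Measure (Config (N + 1) (Fin 3) T3))
    [IsProbabilityMeasure Q] {U : Set V3} (hU : MeasurableSet U) (ρ : Measure (PointConfig (V3 × V3))) [IsProbabilityMeasure ρ] :
    klDiv (windowLaw U (blowUpLaw σ (fun _ => (1 : ℝ)) N Q)) ρ ≤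
      ∫⁻ x, klDiv (windowLaw U (Q.map (blowUp (hsDiameter σ N) x))) ρ := by
  have hF : Measurable (windowRestrict U ∘ fun p : T3 × Config (N + 1) (Fin 3) T3 => blowUp (hsDiameter σ N) p.1 p.2) :=
    (measurable_windowRestrict hU).comp (measurable_blowUp _ _)
  rw [blowUpLaw, weightLaw_one, Literature.MathematicalPhysics.KineticTheory.PointProcess.windowLaw,
    Measure.map_map (measurable_windowRestrict hU) (measurable_blowUp _ _)]
  refine (c9_klDiv_map_prod_le_lintegral_const volume Q ρ hF).trans (le_of_eq (lintegral_congr fun x => ?_))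
  rw [Literature.MathematicalPhysics.KineticTheory.PointProcess.windowLaw,
    Measure.map_map (measurable_windowRestrict hU) (measurable_blowUp_left _ x _)]
  rfl

/-- **Moving the window by the seam lemma and translation invariance.** For a translation-invariant probability reference `G`,
a measurable window `U` whose translate `a + U` lies in the closed ball of radius `R`, and `2ε(R + ‖a‖) < 1`: the window-`U`
entropy of the blow-up around `x` relative to `G_U` equals the window-`(a + U)` entropy of the blow-up around the shifted base
point `x - proj (ε a)` relative to `G_{a+U}` (`windowRestrict_translate_blowUp`, `c9_klDiv_map_translate_eq`). -/
theorem klDiv_windowLaw_blowUp_eq_translate {ε R : ℝ} (hε : 0 < ε) {a : V3} (hR : 2 * ε * (R + ‖a‖) < 1) {U : Set V3}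
    (hU : MeasurableSet U) (hW : (a + ·) '' U ⊆ closedBall (0 : V3) R) (x : T3) {M : ℕ} (Q : Measure (Config M (Fin 3) T3))
    [IsProbabilityMeasure Q] (G : Measure (PointConfig (V3 × V3))) [IsProbabilityMeasure G] (hGT : IsTranslationInvariant G) :
    klDiv (windowLaw U (Q.map (blowUp ε x))) (windowLaw U G) =
      klDiv (windowLaw ((a + ·) '' U) (Q.map (blowUp ε (x - proj (ε • a))))) (windowLaw ((a + ·) '' U) G) := by
  have hW' : MeasurableSet ((a + ·) '' U) := measurableSet_image_const_add hU a
  have hτ := PointConfig.measurable_translate (E := V3 × V3) ((a, 0) : V3 × V3)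
  have hpre : (· + a) ⁻¹' ((a + ·) '' U) = U := preimage_add_const_image_const_add a U
  haveI : IsProbabilityMeasure (Q.map (blowUp ε x)) :=
    Measure.isProbabilityMeasure_map (measurable_blowUp_left ε x M).aemeasurable
  haveI := isProbabilityMeasure_windowLaw (M := V3) hU (Q.map (blowUp ε x))
  haveI := isProbabilityMeasure_windowLaw (M := V3) hU G
  have h1 : windowLaw ((a + ·) '' U) (Q.map (blowUp ε (x - proj (ε • a)))) =
      (windowLaw U (Q.map (blowUp ε x))).map (PointConfig.translate ((a, 0) : V3 × V3)) := by
    rw [Literature.MathematicalPhysics.KineticTheory.PointProcess.windowLaw,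
      Literature.MathematicalPhysics.KineticTheory.PointProcess.windowLaw,
      Measure.map_map (measurable_windowRestrict hW') (measurable_blowUp_left ε _ M),
      Measure.map_map (measurable_windowRestrict hU) (measurable_blowUp_left ε x M),
      Measure.map_map hτ ((measurable_windowRestrict hU).comp (measurable_blowUp_left ε x M))]
    congr 1
    funext z
    simp only [Function.comp_apply]
    rw [← windowRestrict_translate_blowUp hε hR hW x z, windowRestrict_translate]
    exact congrArg (fun s : Set V3 => (windowRestrict s (blowUp ε x z)).translate ((a, 0) : V3 × V3)) hpre
  have h2 : windowLaw ((a + ·) '' U) G = (windowLaw U G).map (PointConfig.translate ((a, 0) : V3 × V3)) := by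
    conv_lhs => rw [← hGT a]
    rw [windowLaw_map_translate hW']
    exact congrArg (fun s : Set V3 => (windowLaw s G).map (PointConfig.translate ((a, 0) : V3 × V3))) hpre
  rw [h1, h2, c9_klDiv_map_translate_eq]

/-- `cell j = corner j + cell 0` as sets. -/
theorem image_corner_add_c9Cell_zero (S : ℝ) {m : ℕ} (hm : 0 < m) (j : Fin 3 → Fin m) :
    (c9CellCorner S m j + ·) '' c9Cell S m (fun _ => ⟨0, hm⟩) = c9Cell S m j := by
  ext y
  constructor
  · rintro ⟨y', hy', rfl⟩
    rw [mem_c9Cell_iff_sub_corner_mem S hm, add_sub_cancel_left]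
    exact hy'
  · intro hy
    exact ⟨y - c9CellCorner S m j, (mem_c9Cell_iff_sub_corner_mem S hm j y).1 hy, add_sub_cancel (c9CellCorner S m j) y⟩

/-- **Every cell term is a cell-`0` term at a shifted base point**: by the cell seam lemma
`c9_windowRestrict_cell_blowUp_eq_translate`, the translation covariance of the free measure `c9_gibbsSpecMeasure_empty_translate`
and the translation invariance of the relative entropy,
`KL((Q ∘ blowUp_y⁻¹)_{cell j} ‖ γ_{cell j}) = KL((Q ∘ blowUp_{y + proj(ε corner j)}⁻¹)_{cell 0} ‖ γ_{cell 0})`. -/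
theorem klDiv_windowLaw_c9Cell_eq {ε : ℝ} (hε : 0 < ε) {m : ℕ} (hm : 0 < m) (j : Fin 3 → Fin m) {z β : ℝ} (hz : 0 ≤ z)
    (hβ : 0 < β) (u : V3) (y : T3) {M : ℕ} (Q : Measure (Config M (Fin 3) T3)) [IsProbabilityMeasure Q] :
    klDiv (windowLaw (c9Cell ε⁻¹ m j) (Q.map (blowUp ε y)))
        (Literature.MathematicalPhysics.KineticTheory.HardSphereDLR.gibbsSpecMeasure 1 z β u (c9Cell ε⁻¹ m j) ∅) =
      klDiv (windowLaw (c9Cell ε⁻¹ m fun _ => ⟨0, hm⟩) (Q.map (blowUp ε (y + proj (ε • c9CellCorner ε⁻¹ m j)))))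
        (Literature.MathematicalPhysics.KineticTheory.HardSphereDLR.gibbsSpecMeasure 1 z β u (c9Cell ε⁻¹ m fun _ => ⟨0, hm⟩) ∅) := by
  have hC0 : MeasurableSet (c9Cell ε⁻¹ m fun _ => ⟨0, hm⟩) := measurableSet_c9Cell _ _ _
  have hCj : MeasurableSet (c9Cell ε⁻¹ m j) := measurableSet_c9Cell _ _ _
  have hτ := PointConfig.measurable_translate (E := V3 × V3) ((c9CellCorner ε⁻¹ m j, 0) : V3 × V3)
  haveI : IsProbabilityMeasure (Literature.MathematicalPhysics.KineticTheory.HardSphereDLR.gibbsSpecMeasure 1 z β u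
      (c9Cell ε⁻¹ m fun _ => ⟨0, hm⟩) ∅) :=
    isProbabilityMeasure_gibbsSpecMeasure_empty hz hβ u hC0 (isBounded_c9Cell _ _ _).measure_lt_top.ne
  haveI : IsProbabilityMeasure (Q.map (blowUp ε (y + proj (ε • c9CellCorner ε⁻¹ m j)))) :=
    Measure.isProbabilityMeasure_map (measurable_blowUp_left ε _ M).aemeasurable
  haveI := isProbabilityMeasure_windowLaw (M := V3) hC0 (Q.map (blowUp ε (y + proj (ε • c9CellCorner ε⁻¹ m j))))
  have h1 : windowLaw (c9Cell ε⁻¹ m j) (Q.map (blowUp ε y)) =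
      (windowLaw (c9Cell ε⁻¹ m fun _ => ⟨0, hm⟩) (Q.map (blowUp ε (y + proj (ε • c9CellCorner ε⁻¹ m j))))).map
        (PointConfig.translate ((c9CellCorner ε⁻¹ m j, 0) : V3 × V3)) := by
    rw [Literature.MathematicalPhysics.KineticTheory.PointProcess.windowLaw,
      Literature.MathematicalPhysics.KineticTheory.PointProcess.windowLaw,
      Measure.map_map (measurable_windowRestrict hCj) (measurable_blowUp_left ε y M),
      Measure.map_map (measurable_windowRestrict hC0) (measurable_blowUp_left ε _ M),
      Measure.map_map hτ ((measurable_windowRestrict hC0).comp (measurable_blowUp_left ε _ M))]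
    congr 1
    funext w
    exact c9_windowRestrict_cell_blowUp_eq_translate hε hm j y w
  have h2 : Literature.MathematicalPhysics.KineticTheory.HardSphereDLR.gibbsSpecMeasure 1 z β u (c9Cell ε⁻¹ m j) ∅ =
      (Literature.MathematicalPhysics.KineticTheory.HardSphereDLR.gibbsSpecMeasure 1 z β u (c9Cell ε⁻¹ m fun _ => ⟨0, hm⟩) ∅).map
        (PointConfig.translate ((c9CellCorner ε⁻¹ m j, 0) : V3 × V3)) := by
    rw [← c9_gibbsSpecMeasure_empty_translate z β u hC0, image_corner_add_c9Cell_zero ε⁻¹ hm j]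
  rw [h1, h2, c9_klDiv_map_translate_eq]

/-- **Alignment**: a translate of the open cube of half-side `h ≤ S/(2m)` by a vector with coordinates bounded by `S/(2m)` lies in
the cell `(m/2, m/2, m/2)` (the cell containing, or cornered at, the origin). -/
theorem exists_image_const_add_subset_c9Cell {S : ℝ} (hS : 0 < S) {m : ℕ} (hm : 0 < m) {h : ℝ} (hh : h ≤ S / m / 2) :
    ∃ (j₀ : Fin 3 → Fin m) (a : V3), (∀ i, |a i| ≤ S / m / 2) ∧
      (a + ·) '' {y : V3 | ∀ i, y i ∈ Ioo (-h) h} ⊆ c9Cell S m j₀ := by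
  have hj : m / 2 < m := Nat.div_lt_self hm one_lt_two
  have hm0 : (0 : ℝ) < m := Nat.cast_pos.2 hm
  have hL : 0 < S / m := div_pos hS hm0
  have h2 : (m : ℝ) - 1 ≤ 2 * ((m / 2 : ℕ) : ℝ) ∧ 2 * ((m / 2 : ℕ) : ℝ) ≤ m := by
    have h := Nat.div_add_mod m 2
    have h' := Nat.mod_lt m two_pos
    constructor
    · have : (m : ℝ) = 2 * ((m / 2 : ℕ) : ℝ) + ((m % 2 : ℕ) : ℝ) := by exact_mod_cast h.symm
      have : ((m % 2 : ℕ) : ℝ) ≤ 1 := by exact_mod_cast Nat.lt_succ_iff.1 h'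
      linarith
    · exact_mod_cast (show 2 * (m / 2) ≤ m by omega)
  -- the centre coordinate of the cell `m / 2`
  set α : ℝ := S / m / 2 * (2 * ((m / 2 : ℕ) : ℝ) + 1 - m) with hα
  have hα0 : 0 ≤ α := mul_nonneg (by positivity) (by linarith)
  have hα1 : α ≤ S / m / 2 := by
    have : S / m / 2 * (2 * ((m / 2 : ℕ) : ℝ) + 1 - m) ≤ S / m / 2 * 1 := mul_le_mul_of_nonneg_left (by linarith) (by positivity)
    linarith
  have hlow : α - S / m / 2 = -S / 2 + ((m / 2 : ℕ) : ℝ) * (S / m) := by rw [hα]; field_simp; ring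
  refine ⟨fun _ => ⟨m / 2, hj⟩, WithLp.toLp 2 fun _ => α, fun i => ?_, ?_⟩
  · rw [PiLp.toLp_apply, abs_of_nonneg hα0]
    exact hα1
  · rintro _ ⟨y, hy, rfl⟩ i
    obtain ⟨hy1, hy2⟩ := hy i
    rw [PiLp.add_apply, PiLp.toLp_apply]
    constructor
    · linarith
    · linarith

/-! ## The window estimate at fixed size -/

/-- **THE WINDOW ESTIMATE AT FIXED SIZE** (main theorem of this file; steps (C)–(E) of the Gibbs route). For `0 < σ ≤ 1/2`,
`a, θ, z > 0`, a size `N` with flow `Φ`, a probability law `Q` on torus phase space, a translation-invariant DLR state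
`G ∈ Gibbs(z)` of the unit-diameter gas, a window index `n` and a number `m ≥ 7` of cells per side of the blown-up torus cube
such that the open cube `U_n = (-(n+2), n+2)³` fits twice into a cell (`2(n+2) ≤ ε⁻¹/m`):
`KL((blowUpLaw σ 1 N Q)_{U_n} ‖ G_{U_n}) ≤ (KL(Q ‖ G_N) + c_N(m)) / m³ + z · C`, `C` any bound on the volumes of the unit collars of the cells.
Proof: convexity in the base point (`klDiv_windowLaw_blowUpLaw_one_le_lintegral`); for each base point, move the window into the
cell `j₀` by the seam lemma and the translation invariance of `G` (`klDiv_windowLaw_blowUp_eq_translate`,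
`exists_image_const_add_subset_c9Cell`), enlarge it to the cell (`klDiv_windowLaw_mono`), swap the reference `G_{cell}` for the
free cell measure at the cost of the unit collar (`c9_klDiv_windowLaw_gibbs_le_klDiv_free_add`),
reduce the cell `j₀` to the cell `0` at a shifted base point (`klDiv_windowLaw_c9Cell_eq`); then the Haar average over the base
point of the cell-`0` term is `m⁻³` times the average of the sum over all cells (`card_mul_lintegral_le_of_forall_sum_le`), which
the cell inequality `hcell` bounds by `KL(Q ‖ G_N) + c_N(m)`. -/
theorem c9_integral_klDiv_window_le_of_cellInequality (hcell : CanonicalCellInequality) {σ a θ z : ℝ} {u₀ : V3}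
    (hσ : 0 < σ) (hσ2 : σ ≤ 1 / 2) (ha : 0 < a) (hθ : 0 < θ) (hz : 0 < z) (N : ℕ)
    (Φ : HardSphereFlow (Literature.Analysis.FluidPDE.Torus.geometry (Fin 3)) (hsDiameter σ N) (N + 1))
    (Q : Measure (Config (N + 1) (Fin 3) T3)) [IsProbabilityMeasure Q]
    {G : Measure (PointConfig (V3 × V3))} (hG : IsHardSphereGibbs 1 z θ⁻¹ u₀ G) (hGT : IsTranslationInvariant G)
    {n m : ℕ} (hm : 7 ≤ m) (hfit : 2 * ((n : ℝ) + 2) ≤ (hsDiameter σ N)⁻¹ / m) {C : ℝ} (hC : 0 ≤ C)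
    (hcol : ∀ j : Fin 3 → Fin m, volume (thickening 1 (c9Cell (hsDiameter σ N)⁻¹ m j) \ c9Cell (hsDiameter σ N)⁻¹ m j) ≤ ENNReal.ofReal C) :
    klDiv (windowLaw {y : V3 | ∀ i, y i ∈ Ioo (-((n : ℝ) + 2)) ((n : ℝ) + 2)} (blowUpLaw σ (fun _ => (1 : ℝ)) N Q))
        (windowLaw {y : V3 | ∀ i, y i ∈ Ioo (-((n : ℝ) + 2)) ((n : ℝ) + 2)} G) ≤
      (klDiv Q (localGibbsLaw σ (fun _ => a) (fun _ => u₀) (fun _ => θ) N Φ) + canonicalBlockConst σ a θ u₀ z N Φ m) /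
          (m : ℝ≥0∞) ^ 3 + ENNReal.ofReal (z * C) := by
  haveI := hG.1
  set ε := hsDiameter σ N with hε'
  have hε : 0 < ε := hsDiameter_pos hσ N
  have hβ : 0 < θ⁻¹ := inv_pos.2 hθ
  have hm0 : 0 < m := by omega
  have hm0' : (0 : ℝ) < m := Nat.cast_pos.2 hm0
  have hS : 0 < ε⁻¹ := inv_pos.2 hε
  set L' := ε⁻¹ / m with hL''
  have hL'0 : 0 < L' := div_pos hS hm0'
  set h : ℝ := (n : ℝ) + 2 with hh'
  have hh0 : 0 < h := by positivity
  have hhL : h ≤ ε⁻¹ / m / 2 := by linarith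
  set U : Set V3 := {y | ∀ i, y i ∈ Ioo (-h) h} with hU'
  have hUm : MeasurableSet U := (isOpen_setOf_forall_apply_mem_Ioo (fun _ => -h) (fun _ => h)).measurableSet
  have hCm : ∀ j : Fin 3 → Fin m, MeasurableSet (c9Cell ε⁻¹ m j) := fun j => measurableSet_c9Cell _ _ _
  have hCb : ∀ j : Fin 3 → Fin m, Bornology.IsBounded (c9Cell ε⁻¹ m j) := fun j => isBounded_c9Cell _ _ _
  -- alignment of a translate of the window inside the cell `j₀`
  obtain ⟨j₀, c, hc, hWcell⟩ := exists_image_const_add_subset_c9Cell hS hm0 hhL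
  have hWm : MeasurableSet ((c + ·) '' U) := measurableSet_image_const_add hUm c
  have hcn : ‖c‖ ≤ L' := by
    have h2 := norm_le_two_mul_of_forall_abs_apply_le (by positivity) hc
    linarith
  have hWball : (c + ·) '' U ⊆ closedBall (0 : V3) (2 * L') := by
    rintro _ ⟨y, hy, rfl⟩
    rw [mem_closedBall, dist_zero_right]
    refine norm_le_two_mul_of_forall_abs_apply_le hL'0.le fun i => ?_
    have h1 := abs_le.1 (hc i)
    obtain ⟨h3, h4⟩ := hy i
    rw [PiLp.add_apply, abs_le]
    constructor <;> linarith
  have hR : 2 * ε * (2 * L' + ‖c‖) < 1 := by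
    have h1 : 2 * ε * (2 * L' + ‖c‖) ≤ 2 * ε * (3 * L') := mul_le_mul_of_nonneg_left (by linarith) (by positivity)
    have h6 : 2 * ε * (3 * L') = 6 / m := by rw [hL'']; field_simp; norm_num
    have h7 : (6 : ℝ) / m < 1 := by rw [div_lt_one hm0']; exact_mod_cast (show 6 < m by omega)
    linarith
  -- the cell-`0` entropy as a function of the base point, and the cell inequality
  set H0 : T3 → ℝ≥0∞ := fun y => klDiv (windowLaw (c9Cell ε⁻¹ m fun _ => ⟨0, hm0⟩) (Q.map (blowUp ε y)))
    (Literature.MathematicalPhysics.KineticTheory.HardSphereDLR.gibbsSpecMeasure 1 z θ⁻¹ u₀ (c9Cell ε⁻¹ m fun _ => ⟨0, hm0⟩) ∅)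
    with hH0
  set B : ℝ≥0∞ := klDiv Q (localGibbsLaw σ (fun _ => a) (fun _ => u₀) (fun _ => θ) N Φ) + canonicalBlockConst σ a θ u₀ z N Φ m
    with hB
  have hsum : ∀ y, ∑ j : Fin 3 → Fin m, H0 (y + proj (ε • c9CellCorner ε⁻¹ m j)) ≤ B := fun y => by
    refine le_trans (le_of_eq (Finset.sum_congr rfl fun j _ => ?_)) (hcell σ a θ u₀ z hσ hσ2 ha hθ hz N Φ y m hm0 Q inferInstance)
    exact (klDiv_windowLaw_c9Cell_eq hε hm0 j hz.le hβ u₀ y Q).symm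
  -- the Haar average of the cell-`0` entropy
  have hH0int : ∫⁻ y, H0 y ≤ B / (m : ℝ≥0∞) ^ 3 := by
    have hcard : (Fintype.card (Fin 3 → Fin m) : ℝ≥0∞) = (m : ℝ≥0∞) ^ 3 := by
      rw [Fintype.card_fun, Fintype.card_fin, Fintype.card_fin]; push_cast; ring
    have h1 := card_mul_lintegral_le_of_forall_sum_le (fun j => proj (ε • c9CellCorner ε⁻¹ m j)) H0 hsum
    rw [hcard, mul_comm] at h1
    exact (ENNReal.le_div_iff_mul_le (Or.inl (pow_ne_zero 3 (Nat.cast_ne_zero.2 hm0.ne'))) (Or.inl (ENNReal.pow_ne_top ENNReal.coe_ne_top))).2 h1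
  -- the pointwise bound in the base point
  haveI := isProbabilityMeasure_windowLaw (M := V3) hUm G
  have hpt : ∀ x, klDiv (windowLaw U (Q.map (blowUp ε x))) (windowLaw U G) ≤
      H0 (x - proj (ε • c) + proj (ε • c9CellCorner ε⁻¹ m j₀)) + ENNReal.ofReal (z * C) := fun x => by
    rw [klDiv_windowLaw_blowUp_eq_translate hε hR hUm hWball x Q G hGT]
    haveI : IsProbabilityMeasure (Q.map (blowUp ε (x - proj (ε • c)))) :=
      Measure.isProbabilityMeasure_map (measurable_blowUp_left ε _ _).aemeasurable
    haveI := isProbabilityMeasure_windowLaw (M := V3) (hCm j₀) (Q.map (blowUp ε (x - proj (ε • c))))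
    calc klDiv (windowLaw ((c + ·) '' U) (Q.map (blowUp ε (x - proj (ε • c))))) (windowLaw ((c + ·) '' U) G)
        ≤ klDiv (windowLaw (c9Cell ε⁻¹ m j₀) (Q.map (blowUp ε (x - proj (ε • c))))) (windowLaw (c9Cell ε⁻¹ m j₀) G) :=
          klDiv_windowLaw_mono hWm (hCm j₀) hWcell _ G
      _ ≤ klDiv (windowLaw (c9Cell ε⁻¹ m j₀) (Q.map (blowUp ε (x - proj (ε • c)))))
            (Literature.MathematicalPhysics.KineticTheory.HardSphereDLR.gibbsSpecMeasure 1 z θ⁻¹ u₀ (c9Cell ε⁻¹ m j₀) ∅) +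
          ENNReal.ofReal (z * (volume (thickening 1 (c9Cell ε⁻¹ m j₀) \ c9Cell ε⁻¹ m j₀)).toReal) :=
          c9_klDiv_windowLaw_gibbs_le_klDiv_free_add hz.le hβ hG (hCm j₀) (hCb j₀) _
      _ ≤ H0 (x - proj (ε • c) + proj (ε • c9CellCorner ε⁻¹ m j₀)) + ENNReal.ofReal (z * C) := by
          rw [klDiv_windowLaw_c9Cell_eq hε hm0 j₀ hz.le hβ u₀ _ Q]
          gcongr
          exact ENNReal.toReal_le_of_le_ofReal hC (hcol j₀)
  -- convexity in the base point and the Haar invariance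
  have hshift : ∫⁻ x, H0 (x - proj (ε • c) + proj (ε • c9CellCorner ε⁻¹ m j₀)) = ∫⁻ y, H0 y := by
    rw [show (∫⁻ x, H0 (x - proj (ε • c) + proj (ε • c9CellCorner ε⁻¹ m j₀))) =
        ∫⁻ x, H0 (x + proj (ε • c9CellCorner ε⁻¹ m j₀)) from
      lintegral_sub_right_eq_self (fun x => H0 (x + proj (ε • c9CellCorner ε⁻¹ m j₀))) (proj (ε • c))]
    exact lintegral_add_right_eq_self H0 _
  calc klDiv (windowLaw U (blowUpLaw σ (fun _ => (1 : ℝ)) N Q)) (windowLaw U G)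
      ≤ ∫⁻ x, klDiv (windowLaw U (Q.map (blowUp ε x))) (windowLaw U G) :=
        klDiv_windowLaw_blowUpLaw_one_le_lintegral Q hUm _
    _ ≤ ∫⁻ x, (H0 (x - proj (ε • c) + proj (ε • c9CellCorner ε⁻¹ m j₀)) + ENNReal.ofReal (z * C)) := lintegral_mono hpt
    _ = (∫⁻ y, H0 y) + ENNReal.ofReal (z * C) := by
        rw [lintegral_add_right _ measurable_const, lintegral_const, measure_univ, mul_one, hshift]
    _ ≤ B / (m : ℝ≥0∞) ^ 3 + ENNReal.ofReal (z * C) := add_le_add hH0int le_rfl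

end Summit.AtomisticToContinuum.HydrodynamicLimit.Theorems.KiferCompactification

end
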